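import Summits.CriticalPhenomena.PercolationContinuityZ3.Theorems.PercNearOneGluingAdditiveGluingEdgeSwitch
import Summits.CriticalPhenomena.PercolationContinuityZ3.Theorems.PercNearOneGluingAdditiveGluingBlockPockets
import HarnessLib

/-! # Crux `PercNearOneGluing.AdditiveGluing` (stmt-CriticalPhenomena-4576) — the INTERPOLATION SWITCH: the block slack is
# concave in every single pair weight, so good designations common to `u[e↦0]` and `u[e↦1]` are good for `u`
# (exchange-certificate form, seat (d) round 4)

Support file (`--supports stmt-CriticalPhenomena-4576`); no definitions, no named facts.

`μ_u = prodBernoulli u`; relays `A ∋ b`; a block `S`; block goodness of `S` at a designation `d` (worst selection)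
`BG(u,S,d) :  μ_u(d↔b) + μ_u(d↮b, d↔S, S↔b) ≤ μ_u(S↔b) + Σ_{W∩A=∅} μ_u(K_S = W) · min_{a∈A} μ_u(a ↔ b in Wᶜ)`.
For ANY pair `e` (anywhere in the graph) write `u₀ = u[e ↦ 0]`, `u₁ = u[e ↦ 1]`, `t = u e`.

* `interpSw_slack_ge` (**concavity in one pair**): `slack_BG(u,S,d) ≥ (1 − t)·slack_BG(u₀,S,d) + t·slack_BG(u₁,S,d)`.
  The reach, the two-point function and the gain are affine in `t` (`stub_oneBondDecomp_k15`); a pocket term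
  `μ(K_S = W)·min_a μ(a ↔ b in Wᶜ)` is affine when `e` meets `W` (the min does not see `e`, `edgeSw_pocketFactor_update`) and
  `constant × concave` when `e` avoids `W` (`{K_S = W}` is determined by the pairs meeting `W`, `blockPocket_determinedBy`; a
  minimum of affine functions is concave).
* `blockGood_of_interp`: hence `BG(u₀,S,d) ∧ BG(u₁,S,d) → BG(u,S,d)`.
* `blockGood_of_interpSwitch` (**the closure**): if `d₀` (resp. `d₁`) bounds `μ_{u₀}(· ↔ b)` (resp. `μ_{u₁}(· ↔ b)`) below on `A`
  and every block disjoint from `A` is `d₀`-good in `u₀` and `d₁`-good in `u₁` (inner induction hypothesis of the cone line on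
  `#positive + #fractional pairs`, which drops for both `u₀` and `u₁` when `0 < u e < 1`), then `S` is `a₀`-good in `u` as soon as
  `τ_{u₀/S}(a₀) ≤ τ_{u₀/S}(d₀)` and `τ_{u₁/S}(a₀) ≤ τ_{u₁/S}(d₁)` (down-set in each endpoint weighting).
This contains the single-edge switch of `…EdgeSwitch.lean` (there `e` is a block edge and the `u₁`-side is served by the bigger
block `insert y S` in `u₀`) and closes the one instance found by this seat's annealing that survives all deletion switches
(n = 8, lab/surv1.json: every block-edge deletion dethrones `a₀`, but `a₀` stays the minimiser on both sides of the pair `{b, a₁}`).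
[cite: KozmaNitzan2024, §5.3 p. 34 (one-edge interpolation, concavity), §3.2 Definition p. 12, Thms 4–5 pp. 12–14]
-/

namespace Summit.CriticalPhenomena.PercolationContinuityZ3.Theorems

open MeasureTheory Set
open Literature.Probability.LatticeModels (prodBernoulli)
open Literature.Probability.Percolation (BondConfig openConn openConnIn openGraph openCluster)
open scoped BigOperators

noncomputable section
open Classical

section InterpSwitch

open Literature.Probability.LatticeModels Literature.Probability.Percolation

variable {n : ℕ}

/-- The kill-set event `{K_S = W}` does not see a pair avoiding `W`. [folklore] -/
theorem interpSw_pocket_update_of_avoid (u : Sym2 (Fin n) → unitInterval) (S W : Finset (Fin n)) (hS : S.Nonempty)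
    (e : Sym2 (Fin n)) (he : ∀ z ∈ e, z ∉ W) (t : unitInterval) :
    (prodBernoulli (Function.update u e t)).real
        {ω : BondConfig (Fin n) | ∀ z : Fin n, (z ∈ W ↔ ω ∈ ⋃ v ∈ S, openConn v z)}
      = (prodBernoulli u).real {ω : BondConfig (Fin n) | ∀ z : Fin n, (z ∈ W ↔ ω ∈ ⋃ v ∈ S, openConn v z)} := by
  refine prodBernoulli_real_eq_of_determinedBy _ u (fun e' he' => ?_) (blockPocket_determinedBy S W hS)
    MeasurableSet.of_discrete
  obtain ⟨x, hxW, hxe'⟩ := (Finset.mem_filter.1 (Finset.mem_coe.1 he')).2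
  have hne : e' ≠ e := fun h => he x (h ▸ hxe') hxW
  exact Function.update_of_ne hne _ _

/-- A connection inside `Wᶜ` is affine in the weight of any pair (one-bond decomposition). [folklore] -/
theorem interpSw_openConnIn_affine (u : Sym2 (Fin n) → unitInterval) (W : Finset (Fin n)) (e : Sym2 (Fin n)) (a b : Fin n) :
    (prodBernoulli u).real (openConnIn ((W : Set (Fin n))ᶜ) a b)
      = (1 - (u e : ℝ)) * (prodBernoulli (Function.update u e 0)).real (openConnIn ((W : Set (Fin n))ᶜ) a b)
        + (u e : ℝ) * (prodBernoulli (Function.update u e 1)).real (openConnIn ((W : Set (Fin n))ᶜ) a b) :=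
  stub_oneBondDecomp_k15 n u e _

/-- **Concavity of the block slack in one pair weight.**  For every pair `e`, with `u₀ = u[e↦0]`, `u₁ = u[e↦1]`, `t = u e`:
`slack_BG(u,S,d) ≥ (1 − t)·slack_BG(u₀,S,d) + t·slack_BG(u₁,S,d)`.  [cite: KozmaNitzan2024, §5.3 p. 34] -/
theorem interpSw_slack_ge (u : Sym2 (Fin n) → unitInterval) (A S : Finset (Fin n)) (b d : Fin n) (e : Sym2 (Fin n))
    (hb : b ∈ A) (hS : S.Nonempty) :
    (1 - (u e : ℝ)) *
          ((prodBernoulli (Function.update u e 0)).real (⋃ v ∈ S, openConn v b)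
            + (∑ W ∈ (Finset.univ : Finset (Finset (Fin n))).filter (fun W => Disjoint W A),
                (prodBernoulli (Function.update u e 0)).real
                    {ω : BondConfig (Fin n) | ∀ z : Fin n, (z ∈ W ↔ ω ∈ ⋃ v ∈ S, openConn v z)}
                  * A.inf' ⟨b, hb⟩ (fun a => (prodBernoulli (Function.update u e 0)).real
                      (openConnIn ((W : Set (Fin n))ᶜ) a b)))
            - ((prodBernoulli (Function.update u e 0)).real (openConn d b)
                + (prodBernoulli (Function.update u e 0)).real
                    ((openConn d b)ᶜ ∩ (⋃ v ∈ S, openConn d v) ∩ (⋃ v ∈ S, openConn v b))))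
        + (u e : ℝ) *
          ((prodBernoulli (Function.update u e 1)).real (⋃ v ∈ S, openConn v b)
            + (∑ W ∈ (Finset.univ : Finset (Finset (Fin n))).filter (fun W => Disjoint W A),
                (prodBernoulli (Function.update u e 1)).real
                    {ω : BondConfig (Fin n) | ∀ z : Fin n, (z ∈ W ↔ ω ∈ ⋃ v ∈ S, openConn v z)}
                  * A.inf' ⟨b, hb⟩ (fun a => (prodBernoulli (Function.update u e 1)).real
                      (openConnIn ((W : Set (Fin n))ᶜ) a b)))
            - ((prodBernoulli (Function.update u e 1)).real (openConn d b)
                + (prodBernoulli (Function.update u e 1)).real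
                    ((openConn d b)ᶜ ∩ (⋃ v ∈ S, openConn d v) ∩ (⋃ v ∈ S, openConn v b))))
      ≤ (prodBernoulli u).real (⋃ v ∈ S, openConn v b)
        + (∑ W ∈ (Finset.univ : Finset (Finset (Fin n))).filter (fun W => Disjoint W A),
            (prodBernoulli u).real {ω : BondConfig (Fin n) | ∀ z : Fin n, (z ∈ W ↔ ω ∈ ⋃ v ∈ S, openConn v z)}
              * A.inf' ⟨b, hb⟩ (fun a => (prodBernoulli u).real (openConnIn ((W : Set (Fin n))ᶜ) a b)))
        - ((prodBernoulli u).real (openConn d b)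
            + (prodBernoulli u).real ((openConn d b)ᶜ ∩ (⋃ v ∈ S, openConn d v) ∩ (⋃ v ∈ S, openConn v b))) := by
  set u₀ := Function.update u e 0 with hu₀
  set u₁ := Function.update u e 1 with hu₁
  have ht0 : 0 ≤ (u e : ℝ) := (u e).2.1
  have ht1 : (u e : ℝ) ≤ 1 := (u e).2.2
  have hR := stub_oneBondDecomp_k15 n u e (⋃ v ∈ S, openConn v b)
  have hT := stub_oneBondDecomp_k15 n u e (openConn d b)
  have hG := stub_oneBondDecomp_k15 n u e ((openConn d b)ᶜ ∩ (⋃ v ∈ S, openConn d v) ∩ (⋃ v ∈ S, openConn v b))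
  -- pockets, termwise: convex combination of the endpoint pockets ≤ pocket of `u`
  have hP : ∀ W ∈ (Finset.univ : Finset (Finset (Fin n))).filter (fun W => Disjoint W A),
      (1 - (u e : ℝ)) * ((prodBernoulli u₀).real {ω : BondConfig (Fin n) | ∀ z : Fin n, (z ∈ W ↔ ω ∈ ⋃ v ∈ S, openConn v z)}
          * A.inf' ⟨b, hb⟩ (fun a => (prodBernoulli u₀).real (openConnIn ((W : Set (Fin n))ᶜ) a b)))
        + (u e : ℝ) * ((prodBernoulli u₁).real {ω : BondConfig (Fin n) | ∀ z : Fin n, (z ∈ W ↔ ω ∈ ⋃ v ∈ S, openConn v z)}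
          * A.inf' ⟨b, hb⟩ (fun a => (prodBernoulli u₁).real (openConnIn ((W : Set (Fin n))ᶜ) a b)))
      ≤ (prodBernoulli u).real {ω : BondConfig (Fin n) | ∀ z : Fin n, (z ∈ W ↔ ω ∈ ⋃ v ∈ S, openConn v z)}
          * A.inf' ⟨b, hb⟩ (fun a => (prodBernoulli u).real (openConnIn ((W : Set (Fin n))ᶜ) a b)) := by
    intro W _
    by_cases hmeet : ∃ z ∈ e, z ∈ W
    · -- `e` meets `W`: the kill-set term is affine, the pocket factor does not see `e`
      obtain ⟨z, hze, hzW⟩ := hmeet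
      have he : ∃ y : Fin n, e = s(z, y) := by
        induction e using Sym2.ind with
        | h p q =>
          rcases Sym2.mem_iff.1 hze with rfl | rfl
          · exact ⟨q, rfl⟩
          · exact ⟨p, Sym2.eq_swap⟩
      obtain ⟨y, rfl⟩ := he
      have h0 : A.inf' ⟨b, hb⟩ (fun a => (prodBernoulli u₀).real (openConnIn ((W : Set (Fin n))ᶜ) a b))
          = A.inf' ⟨b, hb⟩ (fun a => (prodBernoulli u).real (openConnIn ((W : Set (Fin n))ᶜ) a b)) :=
        Finset.inf'_congr ⟨b, hb⟩ rfl fun a _ => edgeSw_pocketFactor_update u W z y a b hzW 0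
      have h1 : A.inf' ⟨b, hb⟩ (fun a => (prodBernoulli u₁).real (openConnIn ((W : Set (Fin n))ᶜ) a b))
          = A.inf' ⟨b, hb⟩ (fun a => (prodBernoulli u).real (openConnIn ((W : Set (Fin n))ᶜ) a b)) :=
        Finset.inf'_congr ⟨b, hb⟩ rfl fun a _ => edgeSw_pocketFactor_update u W z y a b hzW 1
      rw [h0, h1, stub_oneBondDecomp_k15 n u s(z, y)
        {ω : BondConfig (Fin n) | ∀ z : Fin n, (z ∈ W ↔ ω ∈ ⋃ v ∈ S, openConn v z)}]
      exact le_of_eq (by ring)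
    · -- `e` avoids `W`: the kill-set term is constant, the pocket factor is a minimum of affine functions
      push Not at hmeet
      have hK0 := interpSw_pocket_update_of_avoid u S W hS e hmeet 0
      have hK1 := interpSw_pocket_update_of_avoid u S W hS e hmeet 1
      rw [hK0, hK1]
      have hmin : (1 - (u e : ℝ)) * A.inf' ⟨b, hb⟩ (fun a => (prodBernoulli u₀).real (openConnIn ((W : Set (Fin n))ᶜ) a b))
            + (u e : ℝ) * A.inf' ⟨b, hb⟩ (fun a => (prodBernoulli u₁).real (openConnIn ((W : Set (Fin n))ᶜ) a b))
          ≤ A.inf' ⟨b, hb⟩ (fun a => (prodBernoulli u).real (openConnIn ((W : Set (Fin n))ᶜ) a b)) := by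
        refine Finset.le_inf' _ _ fun a ha => ?_
        rw [interpSw_openConnIn_affine u W e a b]
        have i0 := Finset.inf'_le (fun a => (prodBernoulli u₀).real (openConnIn ((W : Set (Fin n))ᶜ) a b)) ha
        have i1 := Finset.inf'_le (fun a => (prodBernoulli u₁).real (openConnIn ((W : Set (Fin n))ᶜ) a b)) ha
        nlinarith [mul_le_mul_of_nonneg_left i0 (sub_nonneg.2 ht1), mul_le_mul_of_nonneg_left i1 ht0]
      have hKnn : 0 ≤ (prodBernoulli u).real {ω : BondConfig (Fin n) | ∀ z : Fin n, (z ∈ W ↔ ω ∈ ⋃ v ∈ S, openConn v z)} :=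
        measureReal_nonneg
      nlinarith [mul_le_mul_of_nonneg_left hmin hKnn]
  have hPsum := Finset.sum_le_sum hP
  rw [Finset.sum_add_distrib, ← Finset.mul_sum, ← Finset.mul_sum] at hPsum
  rw [hR, hT, hG]
  nlinarith [hPsum]

/-- **Block goodness interpolates**: for every pair `e`, `BG(u[e↦0],S,d) ∧ BG(u[e↦1],S,d) → BG(u,S,d)`.
[cite: KozmaNitzan2024, §5.3 p. 34, §3.2 Definition p. 12] -/
theorem blockGood_of_interp (u : Sym2 (Fin n) → unitInterval) (A S : Finset (Fin n)) (b d : Fin n) (e : Sym2 (Fin n))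
    (hb : b ∈ A) (hS : S.Nonempty)
    (h0 : (prodBernoulli (Function.update u e 0)).real (openConn d b)
          + (prodBernoulli (Function.update u e 0)).real
              ((openConn d b)ᶜ ∩ (⋃ v ∈ S, openConn d v) ∩ (⋃ v ∈ S, openConn v b))
        ≤ (prodBernoulli (Function.update u e 0)).real (⋃ v ∈ S, openConn v b)
          + (∑ W ∈ (Finset.univ : Finset (Finset (Fin n))).filter (fun W => Disjoint W A),
              (prodBernoulli (Function.update u e 0)).real
                  {ω : BondConfig (Fin n) | ∀ z : Fin n, (z ∈ W ↔ ω ∈ ⋃ v ∈ S, openConn v z)}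
                * A.inf' ⟨b, hb⟩ (fun a => (prodBernoulli (Function.update u e 0)).real
                    (openConnIn ((W : Set (Fin n))ᶜ) a b))))
    (h1 : (prodBernoulli (Function.update u e 1)).real (openConn d b)
          + (prodBernoulli (Function.update u e 1)).real
              ((openConn d b)ᶜ ∩ (⋃ v ∈ S, openConn d v) ∩ (⋃ v ∈ S, openConn v b))
        ≤ (prodBernoulli (Function.update u e 1)).real (⋃ v ∈ S, openConn v b)
          + (∑ W ∈ (Finset.univ : Finset (Finset (Fin n))).filter (fun W => Disjoint W A),
              (prodBernoulli (Function.update u e 1)).real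
                  {ω : BondConfig (Fin n) | ∀ z : Fin n, (z ∈ W ↔ ω ∈ ⋃ v ∈ S, openConn v z)}
                * A.inf' ⟨b, hb⟩ (fun a => (prodBernoulli (Function.update u e 1)).real
                    (openConnIn ((W : Set (Fin n))ᶜ) a b)))) :
    (prodBernoulli u).real (openConn d b)
          + (prodBernoulli u).real
              ((openConn d b)ᶜ ∩ (⋃ v ∈ S, openConn d v) ∩ (⋃ v ∈ S, openConn v b))
        ≤ (prodBernoulli u).real (⋃ v ∈ S, openConn v b)
          + (∑ W ∈ (Finset.univ : Finset (Finset (Fin n))).filter (fun W => Disjoint W A),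
              (prodBernoulli u).real
                  {ω : BondConfig (Fin n) | ∀ z : Fin n, (z ∈ W ↔ ω ∈ ⋃ v ∈ S, openConn v z)}
                * A.inf' ⟨b, hb⟩ (fun a => (prodBernoulli u).real (openConnIn ((W : Set (Fin n))ᶜ) a b))) := by
  have hge := interpSw_slack_ge u A S b d e hb hS
  have ht0 : 0 ≤ (u e : ℝ) := (u e).2.1
  have ht1 : (u e : ℝ) ≤ 1 := (u e).2.2
  nlinarith [hge, mul_nonneg (sub_nonneg.2 ht1) (sub_nonneg.2 h0), mul_nonneg ht0 (sub_nonneg.2 h1)]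

/-- **THE INTERPOLATION SWITCH.**  For any pair `e`: if `d₀`, `d₁` bound the endpoint two-point functions below on `A`
(e.g. minimisers), every block disjoint from `A` is `d₀`-good in `u[e↦0]` and `d₁`-good in `u[e↦1]` (inner induction
hypothesis), and `a₀` is glued-below `d₀` in `u[e↦0]/S` and glued-below `d₁` in `u[e↦1]/S`, then `S` is `a₀`-good in `u`.
[cite: KozmaNitzan2024, §3.2 Thms 4–5 pp. 12–14, §5.3 p. 34, Question 9 p. 36] -/
theorem blockGood_of_interpSwitch (u : Sym2 (Fin n) → unitInterval) (A S : Finset (Fin n)) (b a₀ d₀ d₁ : Fin n)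
    (e : Sym2 (Fin n)) (hb : b ∈ A) (hSA : Disjoint S A) (hS : S.Nonempty)
    (hle0 : (prodBernoulli (fun e' : Sym2 (Fin n) => if (∀ z ∈ e', z ∈ S) ∧ ¬ e'.IsDiag then 1 else Function.update u e 0 e')).real (openConn a₀ b)
      ≤ (prodBernoulli (fun e' : Sym2 (Fin n) => if (∀ z ∈ e', z ∈ S) ∧ ¬ e'.IsDiag then 1 else Function.update u e 0 e')).real (openConn d₀ b))
    (hle1 : (prodBernoulli (fun e' : Sym2 (Fin n) => if (∀ z ∈ e', z ∈ S) ∧ ¬ e'.IsDiag then 1 else Function.update u e 1 e')).real (openConn a₀ b)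
      ≤ (prodBernoulli (fun e' : Sym2 (Fin n) => if (∀ z ∈ e', z ∈ S) ∧ ¬ e'.IsDiag then 1 else Function.update u e 1 e')).real (openConn d₁ b))
    (hIH0 : ∀ S' : Finset (Fin n), Disjoint S' A →
      (prodBernoulli (Function.update u e 0)).real (openConn d₀ b)
          + (prodBernoulli (Function.update u e 0)).real
              ((openConn d₀ b)ᶜ ∩ (⋃ v ∈ S', openConn d₀ v) ∩ (⋃ v ∈ S', openConn v b))
        ≤ (prodBernoulli (Function.update u e 0)).real (⋃ v ∈ S', openConn v b)
          + (∑ W ∈ (Finset.univ : Finset (Finset (Fin n))).filter (fun W => Disjoint W A),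
              (prodBernoulli (Function.update u e 0)).real
                  {ω : BondConfig (Fin n) | ∀ z : Fin n, (z ∈ W ↔ ω ∈ ⋃ v ∈ S', openConn v z)}
                * A.inf' ⟨b, hb⟩ (fun a => (prodBernoulli (Function.update u e 0)).real
                    (openConnIn ((W : Set (Fin n))ᶜ) a b))))
    (hIH1 : ∀ S' : Finset (Fin n), Disjoint S' A →
      (prodBernoulli (Function.update u e 1)).real (openConn d₁ b)
          + (prodBernoulli (Function.update u e 1)).real
              ((openConn d₁ b)ᶜ ∩ (⋃ v ∈ S', openConn d₁ v) ∩ (⋃ v ∈ S', openConn v b))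
        ≤ (prodBernoulli (Function.update u e 1)).real (⋃ v ∈ S', openConn v b)
          + (∑ W ∈ (Finset.univ : Finset (Finset (Fin n))).filter (fun W => Disjoint W A),
              (prodBernoulli (Function.update u e 1)).real
                  {ω : BondConfig (Fin n) | ∀ z : Fin n, (z ∈ W ↔ ω ∈ ⋃ v ∈ S', openConn v z)}
                * A.inf' ⟨b, hb⟩ (fun a => (prodBernoulli (Function.update u e 1)).real
                    (openConnIn ((W : Set (Fin n))ᶜ) a b)))) :
    (prodBernoulli u).real (openConn a₀ b)
          + (prodBernoulli u).real
              ((openConn a₀ b)ᶜ ∩ (⋃ v ∈ S, openConn a₀ v) ∩ (⋃ v ∈ S, openConn v b))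
        ≤ (prodBernoulli u).real (⋃ v ∈ S, openConn v b)
          + (∑ W ∈ (Finset.univ : Finset (Finset (Fin n))).filter (fun W => Disjoint W A),
              (prodBernoulli u).real
                  {ω : BondConfig (Fin n) | ∀ z : Fin n, (z ∈ W ↔ ω ∈ ⋃ v ∈ S, openConn v z)}
                * A.inf' ⟨b, hb⟩ (fun a => (prodBernoulli u).real (openConnIn ((W : Set (Fin n))ᶜ) a b))) :=
  blockGood_of_interp u A S b a₀ e hb hS
    (blockGood_mono_designated (Function.update u e 0) A S b a₀ d₀ hb hle0 (hIH0 S hSA))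
    (blockGood_mono_designated (Function.update u e 1) A S b a₀ d₁ hb hle1 (hIH1 S hSA))

end InterpSwitch

end

end Summit.CriticalPhenomena.PercolationContinuityZ3.Theorems
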